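import Mathlib
import Literature.Geometry.Lorentzian.KerrConvergence
import Literature.Geometry.Lorentzian.KerrSchild
import Summits.FinalStateConjecture.FinalStateConjecture.Theorems.StarvedNecksFutureOrientedOfSeamedStubRay

/-!
# Route StarvedNecks — crux `GapDecaySuffices` (stmt-FinalStateConjecture-18060), line `Sketch`:
# constant-lab-time inward rays and the kinematic majorant (location bricks for S4)

Def-free bricks consumed by the reduction of the registered stub `stub_anchoredLocation` (S4 v2) to
`SeededLocation` (worker file `work/stubs/StubAnchoredLocationV2.lean`):

* `exists_ray_constLabTime` — on a boosted Kerr background with orthochronous motion, every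
  coordinate point of rest-frame radius `≥ r₀ > max r₊ 0` lies on a preconnected coordinate set of
  CONSTANT lab time `x⁰`, inside the model domain, on which the Kerr–Schild radius stays in
  `[r₀, r(y)]` and which reaches the sphere `{r = r₀}`: the boosted image of the rest-frame path
  `σ ↦ (τ + (1 − σ)ℓ/γ, σξ)` (forward/backward in rest-frame time exactly compensating the boost),
  cut by the intermediate value theorem (star-shapedness of the Kerr–Schild balls,
  `radius_ray_monotone`).  This is the connected carrier of the clopen continuation of S4 (entry of
  the flat collar into the gap chart's tube along sets of constant flat time, on which the flat-domain
  conditions `ρⱼ(x⁰) < rⱼ` are controlled by ONE value of each excision radius).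
* `tendsto_max_abs_add_one_div` — the kinematic majorant `max |Bk| (ρᵢ + 1)` of a sublinear `Bk`
  and a sublinear excision radius is sublinear.

Mathlib + `Literature.Geometry.Lorentzian.KerrConvergence` / `KerrSchild` + the landed ray helpers of
`…FutureOrientedOfSeamedStubRay` (`radius_ray_monotone`, `radius_ofTimeSpace_zero_right`); no
definitions, no named facts.  References: O'Neill, *The geometry of Kerr black holes* (1995), Ch. 2,
§2.1 (Kerr–Schild coordinates); O'Neill 1983, Ch. 9 (Lorentz kinematics).
-/

noncomputable section

open scoped Manifold ContDiff Topology ENNReal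
open Filter Set Topology Literature.Geometry.Lorentzian

namespace Summit.FinalStateConjecture.FinalStateConjecture.Theorems.GapDecaySuffices.Location

set_option linter.dupNamespace false

open Summit.FinalStateConjecture.FinalStateConjecture.Theorems.FutureOrientedOfSeamed.ClockDualityRays
  (radius_ray_monotone radius_ofTimeSpace_zero_right)

/-! ## Constant-lab-time inward rays on a boosted Kerr background -/

/-- Time–space splitting of `(t, y)`: `(t, y) = t e₀ + (0, y)`. [folklore] -/
private theorem ofTimeSpace_eq_smul_add (t : ℝ) (y : E3) :
    E4.ofTimeSpace t y = t • E4.basisVector 0 + E4.ofTimeSpace 0 y := by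
  ext i
  refine Fin.cases ?_ (fun j => ?_) i
  · simp
  · simp [Fin.succ_ne_zero]

/-- `(0, σ y) = σ (0, y)`. [folklore] -/
private theorem ofTimeSpace_zero_smul (σ : ℝ) (y : E3) :
    E4.ofTimeSpace 0 (σ • y) = σ • E4.ofTimeSpace 0 y := by
  ext i
  refine Fin.cases ?_ (fun j => ?_) i
  · simp
  · simp

/-- The Kerr–Schild radius of `(t, y)` does not depend on the time `t`. [folklore] -/
private theorem radius_ofTimeSpace_time (a t t' : ℝ) (y : E3) :
    Kerr.radius a (E4.ofTimeSpace t y) = Kerr.radius a (E4.ofTimeSpace t' y) := by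
  have h3 : E4.ofTimeSpace t y 3 = y 2 := by
    have h := E4.ofTimeSpace_apply_succ t y 2
    simpa using h
  have h3' : E4.ofTimeSpace t' y 3 = y 2 := by
    have h := E4.ofTimeSpace_apply_succ t' y 2
    simpa using h
  unfold Kerr.radius
  rw [E4.spatialNorm_ofTimeSpace, E4.spatialNorm_ofTimeSpace, h3, h3']

/-- **Constant-lab-time inward rays.**  On a boosted Kerr background with orthochronous motion
`(Λ, c)` (`(Λe₀)⁰ > 0`), every coordinate point `y` whose rest-frame Kerr–Schild radius is at least
`r₀ > max r₊ 0` lies on a preconnected coordinate set `S` inside the model domain, of CONSTANT lab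
time `z⁰ = y⁰`, on which the radius stays in `[r₀, r(y)]` and which contains a point of radius exactly
`r₀`: the boosted image of the rest-frame path `σ ↦ (τ + (1 − σ)ℓ/γ, σξ)`, `ℓ = (Λ(0, ξ))⁰`,
`γ = (Λe₀)⁰`, along which lab time is constant and the radius is that of `(·, σξ)`, monotone in `σ`
(`radius_ray_monotone`) and `0` at `σ = 0`, cut at `r = r₀` by the intermediate value theorem.
O'Neill 1995, Ch. 2, §2.1. [folklore] -/
theorem exists_ray_constLabTime (Λ : lorentzGroup) (c : E4) (M a : ℝ)
    (hv : 0 < ((Λ : E4 ≃L[ℝ] E4) (E4.basisVector 0)) 0) (y : E4) {r₀ : ℝ}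
    (hr₀ : max (Kerr.rPlus M a) 0 < r₀) (hr₀y : r₀ ≤ (boostedKerrBackground Λ c M a).radius y) :
    ∃ S : Set E4, IsPreconnected S ∧ y ∈ S ∧
      S ⊆ ((boostedKerrBackground Λ c M a).domain : Set E4) ∧
      (∀ z ∈ S, z 0 = y 0 ∧ r₀ ≤ (boostedKerrBackground Λ c M a).radius z ∧
        (boostedKerrBackground Λ c M a).radius z ≤ (boostedKerrBackground Λ c M a).radius y) ∧
      ∃ z ∈ S, (boostedKerrBackground Λ c M a).radius z = r₀ := by
  -- notation
  set L : E4 ≃L[ℝ] E4 := (Λ : E4 ≃L[ℝ] E4) with hLdef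
  set e₀ : E4 := E4.basisVector 0 with he₀
  set v0 : ℝ := L e₀ 0 with hv0def
  have hv0 : 0 < v0 := hv
  set x' : E4 := poincareInv Λ c y with hx'def
  set τ : ℝ := x' 0 with hτdef
  set ξ : E3 := E4.spatial x' with hξdef
  have hx' : x' = E4.ofTimeSpace τ ξ := (E4.ofTimeSpace_time_spatial x').symm
  set ζ : E4 := E4.ofTimeSpace 0 ξ with hζdef
  set ℓ : ℝ := L ζ 0 with hℓdef
  set m : ℝ := ℓ / v0 with hmdef
  have hmv : m * v0 = ℓ := div_mul_cancel₀ _ hv0.ne'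
  -- the rest-frame path, its boosted image, and the radius along the ray
  let p : ℝ → E4 := fun σ ↦ (τ + (1 - σ) * m) • e₀ + σ • ζ
  let γ : ℝ → E4 := fun σ ↦ L (p σ) + c
  let f : ℝ → ℝ := fun σ ↦ Kerr.radius a (E4.ofTimeSpace τ (σ • ξ))
  have hp : ∀ σ, p σ = E4.ofTimeSpace (τ + (1 - σ) * m) (σ • ξ) := by
    intro σ
    rw [ofTimeSpace_eq_smul_add, ofTimeSpace_zero_smul]
  have hγinv : ∀ σ, poincareInv Λ c (γ σ) = p σ := by
    intro σ
    simp only [γ, poincareInv, add_sub_cancel_right, hLdef, ContinuousLinearEquiv.symm_apply_apply]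
  have hp1 : p 1 = x' := by
    rw [hp, hx', sub_self, zero_mul, add_zero, one_smul]
  have hγ1 : γ 1 = y := by
    have h : L (poincareInv Λ c y) + c = y := by
      simp only [poincareInv, hLdef, ContinuousLinearEquiv.apply_symm_apply, sub_add_cancel]
    show L (p 1) + c = y
    rw [hp1]
    exact h
  have hpc : Continuous p := by
    show Continuous fun σ : ℝ ↦ (τ + (1 - σ) * m) • e₀ + σ • ζ
    fun_prop
  have hγc : Continuous γ := (L.continuous.comp hpc).add continuous_const
  have hfc : Continuous f :=
    (Kerr.continuous_radius a).comp
      ((E4.continuous_ofTimeSpace τ).comp (continuous_id.smul continuous_const))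
  have hf0 : f 0 = 0 := by
    show Kerr.radius a (E4.ofTimeSpace τ ((0 : ℝ) • ξ)) = 0
    rw [zero_smul]
    exact radius_ofTimeSpace_zero_right a τ
  have hf1 : f 1 = Kerr.radius a x' := by
    show Kerr.radius a (E4.ofTimeSpace τ ((1 : ℝ) • ξ)) = _
    rw [one_smul, hx']
  have hrad : ∀ σ, Kerr.radius a (poincareInv Λ c (γ σ)) = f σ := by
    intro σ
    rw [hγinv, hp]
    exact radius_ofTimeSpace_time a _ τ _
  -- lab time is constant along the path
  have hlab : ∀ σ, γ σ 0 = (τ + (1 - σ) * m) * v0 + σ * ℓ + c 0 := by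
    intro σ
    show (L ((τ + (1 - σ) * m) • e₀ + σ • ζ) + c) 0 = _
    rw [map_add, map_smul, map_smul]
    rfl
  have hy0 : y 0 = τ * v0 + ℓ + c 0 := by
    have h := hlab 1
    rw [hγ1] at h
    rw [h]
    ring
  have hlab_eq : ∀ σ, γ σ 0 = y 0 := by
    intro σ
    rw [hlab, hy0]
    have h : (1 - σ) * m * v0 = (1 - σ) * ℓ := by rw [mul_assoc, hmv]
    linear_combination h
  -- cut the ray at `r = r₀`
  have hr₀pos : 0 < r₀ := (le_max_right _ _).trans_lt hr₀
  have hyr : r₀ ≤ Kerr.radius a x' := hr₀y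
  obtain ⟨σ₀, hσ₀, hfσ₀⟩ : ∃ σ₀ ∈ Icc (0 : ℝ) 1, f σ₀ = r₀ :=
    intermediate_value_Icc zero_le_one hfc.continuousOn
      ⟨by rw [hf0]; exact hr₀pos.le, by rw [hf1]; exact hyr⟩
  have hseg : ∀ σ ∈ Icc σ₀ 1, r₀ ≤ f σ ∧ f σ ≤ Kerr.radius a x' := by
    intro σ hσ
    have hlo : f σ₀ ≤ f σ := radius_ray_monotone a τ ξ hσ₀.1 hσ.1
    have hhi : f σ ≤ f 1 := radius_ray_monotone a τ ξ (hσ₀.1.trans hσ.1) hσ.2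
    rw [hfσ₀] at hlo
    rw [hf1] at hhi
    exact ⟨hlo, hhi⟩
  refine ⟨γ '' Icc σ₀ 1, isPreconnected_Icc.image γ hγc.continuousOn,
    ⟨1, right_mem_Icc.mpr hσ₀.2, hγ1⟩, ?_, ?_, ⟨γ σ₀, ⟨σ₀, left_mem_Icc.mpr hσ₀.2, rfl⟩, ?_⟩⟩
  · rintro _ ⟨σ, hσ, rfl⟩
    show poincareInv Λ c (γ σ) ∈ Kerr.exterior M a
    rw [Kerr.mem_exterior, hrad]
    exact hr₀.trans_le (hseg σ hσ).1
  · rintro _ ⟨σ, hσ, rfl⟩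
    refine ⟨hlab_eq σ, ?_, ?_⟩
    · show r₀ ≤ Kerr.radius a (poincareInv Λ c (γ σ))
      rw [hrad]
      exact (hseg σ hσ).1
    · show Kerr.radius a (poincareInv Λ c (γ σ)) ≤ Kerr.radius a x'
      rw [hrad]
      exact (hseg σ hσ).2
  · show Kerr.radius a (poincareInv Λ c (γ σ₀)) = r₀
    rw [hrad]
    exact hfσ₀

/-! ## Small real-variable helpers -/

/-- The kinematic majorant `max |Bk| (ρ + 1)` of two sublinear functions is sublinear. [folklore] -/
theorem tendsto_max_abs_add_one_div {f g : ℝ → ℝ} (hf : Tendsto (fun s ↦ f s / s) atTop (𝓝 0))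
    (hg : Tendsto (fun s ↦ g s / s) atTop (𝓝 0)) :
    Tendsto (fun s ↦ max |f s| (g s + 1) / s) atTop (𝓝 0) := by
  have h1 : Tendsto (fun s ↦ |f s / s|) atTop (𝓝 0) := by simpa using hf.abs
  have h2 : Tendsto (fun s ↦ (g s + 1) / s) atTop (𝓝 0) := by
    have h : Tendsto (fun s : ℝ ↦ g s / s + 1 / s) atTop (𝓝 (0 + 0)) :=
      hg.add (tendsto_const_nhds.div_atTop tendsto_id)
    rw [add_zero] at h
    refine h.congr' ?_
    filter_upwards [eventually_gt_atTop 0] with s hs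
    rw [add_div]
  have h3 := h1.max h2
  rw [max_self] at h3
  refine h3.congr' ?_
  filter_upwards [eventually_gt_atTop 0] with s hs
  rw [abs_div, abs_of_pos hs, max_div_div_right hs.le]

end Summit.FinalStateConjecture.FinalStateConjecture.Theorems.GapDecaySuffices.Location

end
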